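import Summits.CriticalPhenomena.PercolationContinuityZ3.Theorems.PercNearOneGluingNoHeavyLowerTailTraceGluing
import HarnessLib

/-!
# `NoHeavyLowerTail` (stmt-CriticalPhenomena-4575) — the SINK-TRACE LONELY-RELAY INEQUALITY (all `|A|`):
# `Σ_{x ∈ A} P(o ↔ x | C_b ∩ A = A ∖ x) ≤ P(o ↔ A | A ↮ b)`

Support file (prover prim-gen-kcluster gen 3; `--supports stmt-CriticalPhenomena-4575`).  No definitions, no sorries.
Setting: `μ = prodBernoulli w` on a finite vertex type, observer `o`, sink `b ∉ A`, relay set `A`.  For `x ∈ A` let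
`τ_x = {x ↮ b} ∩ {a ↔ b ∀ a ∈ A∖x}` ("the trace of the sink's cluster on `A` is exactly `A ∖ x`"), `D_A = {A ↮ b}`, and
`M = D_A ∩ {A pairwise separated}`.

* `sinkTrace_lonelyRelay` (PROVED, for `μ(M) > 0`):  `Σ_{x∈A} μ(o↔x ∩ τ_x)/μ(τ_x) ≤ μ(o↔A ∩ D_A)/μ(D_A)`.
  For `|A| = 2` this is `traceGluing_two`.  Order-free; the `k`-cluster ("sink-trace") conditional-association
  statement asked for by the k-cluster line: o's single-relay events, conditioned on the complementary traces of the
  sink's cluster, glue to at most one exit under the all-cut conditioning.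
* the three exchange rows it is made of (each ONE instance of `Literature.…setTwoClusterExchange`, BHK 2006 Thm 2.1 at
  `q = 1` with vertex sets): `trace_le_lonely` (`P(o↔x | τ_x) ≤ P(o↔x | x ↮ A∖x ∪ b)`, `S = {x}`, `T = A∖x ∪ b`),
  `lonely_le_sep` (`P(o↔x | x ↮ A∖x ∪ b) ≤ P(o↔x | M)`, same `S, T`), `join_sep_le` (`P(o↔A | M) ≤ P(o↔A | D_A)`,
  `S = {b}`, `T = A`); and the disjointness of `{o↔x} ∩ M`, `x ∈ A` (Kozma–Nitzan's Lemma-2 mechanism).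
-/

noncomputable section

namespace Summit.CriticalPhenomena.PercolationContinuityZ3.Theorems

open MeasureTheory Set Literature.Probability.LatticeModels Literature.Probability.Percolation
open scoped Classical BigOperators
open PathExchange (rs)

namespace SinkTrace

variable {V : Type*}

/-- Row 1 (raw): with `S = {x}`, `T = insert b (A.erase x)`, `R = {x ↮ T}`:
`μ(R ∩ {x↔o} ∩ ⋂_{a∈A∖x}{b↔a}) · μ(R) ≤ μ(R ∩ {x↔o}) · μ(R ∩ ⋂_{a∈A∖x}{b↔a})`.
[cite: VandenbergHaggstromKahn2005, Thm. 2.1 (p. 9) at q = 1 with Remark 1 (p. 5) — corollary via `setTwoClusterExchange`, derived in this file] -/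
theorem trace_le_lonely_set [Fintype V] (w : Sym2 V → unitInterval) (A : Finset V) (o b x : V) :
    (prodBernoulli w).real ({ω : BondConfig V | ∀ s ∈ ({x} : Set V), ∀ t ∈ (insert b ↑(A.erase x) : Set V),
        ¬ (openGraph ω).Reachable s t} ∩ ((openConn x o : Set (BondConfig V)) ∩
          ⋂ a ∈ A.erase x, (openConn b a : Set (BondConfig V)))) *
      (prodBernoulli w).real ({ω : BondConfig V | ∀ s ∈ ({x} : Set V), ∀ t ∈ (insert b ↑(A.erase x) : Set V),
        ¬ (openGraph ω).Reachable s t} ∩ (univ ∩ univ)) ≤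
    (prodBernoulli w).real ({ω : BondConfig V | ∀ s ∈ ({x} : Set V), ∀ t ∈ (insert b ↑(A.erase x) : Set V),
        ¬ (openGraph ω).Reachable s t} ∩ ((openConn x o : Set (BondConfig V)) ∩ univ)) *
      (prodBernoulli w).real ({ω : BondConfig V | ∀ s ∈ ({x} : Set V), ∀ t ∈ (insert b ↑(A.erase x) : Set V),
        ¬ (openGraph ω).Reachable s t} ∩ ((⋂ a ∈ A.erase x, (openConn b a : Set (BondConfig V))) ∩ univ)) := by
  set S : Set V := {x} with hS
  set T : Set V := insert b ↑(A.erase x) with hT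
  have hxS : x ∈ S := by rw [hS]; exact mem_singleton x
  have hbT : b ∈ T := by rw [hT]; exact mem_insert b _
  exact setTwoClusterExchange w S T
    (A₁ := (openConn x o : Set (BondConfig V))) (A₂ := univ)
    (B₁ := ⋂ a ∈ A.erase x, (openConn b a : Set (BondConfig V))) (B₂ := univ)
    (fun ω ω' hs ht h => TwoSetExchange.typePlus_openConn_of_mem S T hxS o hs ht h)
    (fun _ _ _ _ _ => mem_univ _)
    (fun ω ω' hs ht h => mem_iInter₂.2 fun a ha =>
      TwoSetExchange.typeMinus_openConn_of_mem S T hbT a hs ht (mem_iInter₂.1 h a ha))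
    (fun _ _ _ _ _ => mem_univ _)

/-- Row 2 (raw): with `S = {x}`, `T = insert b (A.erase x)`, `R = {x ↮ T}` and
`N = ⋂_{a∈A∖x} {b↮a} ∩ ⋂_{a≠a'∈A∖x} {a↮a'}`:  `μ(R ∩ {x↔o}) · μ(R ∩ N) ≤ μ(R ∩ {x↔o} ∩ N) · μ(R)`.
[cite: VandenbergHaggstromKahn2005, Thm. 2.1 (p. 9) at q = 1 with Remark 1 (p. 5) — corollary via `setTwoClusterExchange`, derived in this file] -/
theorem lonely_le_sep_set [Fintype V] (w : Sym2 V → unitInterval) (A : Finset V) (o b x : V) :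
    (prodBernoulli w).real ({ω : BondConfig V | ∀ s ∈ ({x} : Set V), ∀ t ∈ (insert b ↑(A.erase x) : Set V),
        ¬ (openGraph ω).Reachable s t} ∩ ((openConn x o : Set (BondConfig V)) ∩ univ)) *
      (prodBernoulli w).real ({ω : BondConfig V | ∀ s ∈ ({x} : Set V), ∀ t ∈ (insert b ↑(A.erase x) : Set V),
        ¬ (openGraph ω).Reachable s t} ∩
          (((⋂ a ∈ A.erase x, (openConn b a : Set (BondConfig V))ᶜ) ∩
            ⋂ a ∈ A.erase x, ⋂ a' ∈ (A.erase x).erase a, (openConn a a' : Set (BondConfig V))ᶜ) ∩ univ)) ≤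
    (prodBernoulli w).real ({ω : BondConfig V | ∀ s ∈ ({x} : Set V), ∀ t ∈ (insert b ↑(A.erase x) : Set V),
        ¬ (openGraph ω).Reachable s t} ∩ ((openConn x o : Set (BondConfig V)) ∩
          ((⋂ a ∈ A.erase x, (openConn b a : Set (BondConfig V))ᶜ) ∩
            ⋂ a ∈ A.erase x, ⋂ a' ∈ (A.erase x).erase a, (openConn a a' : Set (BondConfig V))ᶜ))) *
      (prodBernoulli w).real ({ω : BondConfig V | ∀ s ∈ ({x} : Set V), ∀ t ∈ (insert b ↑(A.erase x) : Set V),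
        ¬ (openGraph ω).Reachable s t} ∩ (univ ∩ univ)) := by
  set S : Set V := {x} with hS
  set T : Set V := insert b ↑(A.erase x) with hT
  have hxS : x ∈ S := by rw [hS]; exact mem_singleton x
  have hbT : b ∈ T := by rw [hT]; exact mem_insert b _
  have haT : ∀ a ∈ A.erase x, a ∈ T := fun a ha => by
    rw [hT]; exact mem_insert_of_mem b (Finset.mem_coe.2 ha)
  exact setTwoClusterExchange w S T
    (A₁ := (openConn x o : Set (BondConfig V)))
    (A₂ := (⋂ a ∈ A.erase x, (openConn b a : Set (BondConfig V))ᶜ) ∩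
      ⋂ a ∈ A.erase x, ⋂ a' ∈ (A.erase x).erase a, (openConn a a' : Set (BondConfig V))ᶜ)
    (B₁ := univ) (B₂ := univ)
    (fun ω ω' hs ht h => TwoSetExchange.typePlus_openConn_of_mem S T hxS o hs ht h)
    (fun ω ω' hs ht h => ⟨mem_iInter₂.2 fun a ha =>
        TwoSetExchange.typePlus_not_openConn_of_mem S T hbT a hs ht (mem_iInter₂.1 h.1 a ha),
      mem_iInter₂.2 fun a ha => mem_iInter₂.2 fun a' ha' =>
        TwoSetExchange.typePlus_not_openConn_of_mem S T (haT a ha) a' hs ht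
          (mem_iInter₂.1 (mem_iInter₂.1 h.2 a ha) a' ha')⟩)
    (fun _ _ _ _ _ => mem_univ _) (fun _ _ _ _ _ => mem_univ _)

/-- Row 3 (raw): with `S = {b}`, `T = A`, `D = {b ↮ A}`, `P = ⋂_{a≠a'∈A}{a↮a'}`, `O = ⋃_{a∈A}{a↔o}`:
`μ(D ∩ P ∩ O) · μ(D) ≤ μ(D ∩ P) · μ(D ∩ O)`.
[cite: VandenbergHaggstromKahn2005, Thm. 2.1 (p. 9) at q = 1 with Remark 1 (p. 5) — corollary via `setTwoClusterExchange`, derived in this file] -/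
theorem join_sep_le_set [Fintype V] (w : Sym2 V → unitInterval) (A : Finset V) (o b : V) :
    (prodBernoulli w).real ({ω : BondConfig V | ∀ s ∈ ({b} : Set V), ∀ t ∈ (↑A : Set V),
        ¬ (openGraph ω).Reachable s t} ∩
          ((⋂ a ∈ A, ⋂ a' ∈ A.erase a, (openConn a a' : Set (BondConfig V))ᶜ) ∩
            ⋃ a ∈ A, (openConn a o : Set (BondConfig V)))) *
      (prodBernoulli w).real ({ω : BondConfig V | ∀ s ∈ ({b} : Set V), ∀ t ∈ (↑A : Set V),
        ¬ (openGraph ω).Reachable s t} ∩ (univ ∩ univ)) ≤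
    (prodBernoulli w).real ({ω : BondConfig V | ∀ s ∈ ({b} : Set V), ∀ t ∈ (↑A : Set V),
        ¬ (openGraph ω).Reachable s t} ∩
          ((⋂ a ∈ A, ⋂ a' ∈ A.erase a, (openConn a a' : Set (BondConfig V))ᶜ) ∩ univ)) *
      (prodBernoulli w).real ({ω : BondConfig V | ∀ s ∈ ({b} : Set V), ∀ t ∈ (↑A : Set V),
        ¬ (openGraph ω).Reachable s t} ∩ ((⋃ a ∈ A, (openConn a o : Set (BondConfig V))) ∩ univ)) := by
  set S : Set V := {b} with hS
  set T : Set V := ↑A with hT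
  have haT : ∀ a ∈ A, a ∈ T := fun a ha => by rw [hT]; exact Finset.mem_coe.2 ha
  exact setTwoClusterExchange w S T
    (A₁ := ⋂ a ∈ A, ⋂ a' ∈ A.erase a, (openConn a a' : Set (BondConfig V))ᶜ) (A₂ := univ)
    (B₁ := ⋃ a ∈ A, (openConn a o : Set (BondConfig V))) (B₂ := univ)
    (fun ω ω' hs ht h => mem_iInter₂.2 fun a ha => mem_iInter₂.2 fun a' ha' =>
      TwoSetExchange.typePlus_not_openConn_of_mem S T (haT a ha) a' hs ht
        (mem_iInter₂.1 (mem_iInter₂.1 h a ha) a' ha'))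
    (fun _ _ _ _ _ => mem_univ _)
    (fun ω ω' hs ht h => by
      obtain ⟨a, ha, hω⟩ := mem_iUnion₂.1 h
      exact mem_iUnion₂.2 ⟨a, ha, TwoSetExchange.typeMinus_openConn_of_mem S T (haT a ha) o hs ht hω⟩)
    (fun _ _ _ _ _ => mem_univ _)

/-! ### Reading the raw events -/

section Events

variable (A : Finset V) (o b x : V)

/-- `{x ↮ T}` for `T = insert b (A.erase x)` is `{x ↮ b} ∩ {x ↮ A∖x}`. [folklore] -/
theorem mem_sepX_iff (hb : b ∉ A) (ω : BondConfig V) :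
    ω ∈ {ω : BondConfig V | ∀ s ∈ ({x} : Set V), ∀ t ∈ (insert b ↑(A.erase x) : Set V),
        ¬ (openGraph ω).Reachable s t} ↔
      (¬ (openGraph ω).Reachable x b ∧ ∀ a ∈ A, a ≠ x → ¬ (openGraph ω).Reachable x a) := by
  have _ := hb
  simp only [mem_setOf_eq, mem_singleton_iff, forall_eq, mem_insert_iff, Finset.mem_coe, Finset.mem_erase]
  constructor
  · intro h
    exact ⟨h b (Or.inl rfl), fun a ha hax => h a (Or.inr ⟨hax, ha⟩)⟩
  · rintro ⟨hb', ha'⟩ t ht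
    rcases ht with rfl | ⟨htx, htA⟩
    · exact hb'
    · exact ha' t htA htx

end Events

/-- The events `{o ↔ x} ∩ M`, `x ∈ A`, are pairwise disjoint (`M ⊆ {A pairwise separated}`). [folklore] -/
theorem pairwiseDisjoint_conn_inter_sep (A : Finset V) (o : V) (M : Set (BondConfig V))
    (hM : M ⊆ {ω : BondConfig V | ∀ a ∈ A, ∀ a' ∈ A, a ≠ a' → ¬ (openGraph ω).Reachable a a'}) :
    (↑A : Set V).PairwiseDisjoint fun a => (openConn o a : Set (BondConfig V)) ∩ M := by
  intro a ha a' ha' hne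
  simp only [Function.onFun]
  refine Set.disjoint_left.2 fun ω hω hω' => ?_
  have hoa : (openGraph ω).Reachable o a := hω.1
  have hoa' : (openGraph ω).Reachable o a' := hω'.1
  exact hM hω.2 a (Finset.mem_coe.1 ha) a' (Finset.mem_coe.1 ha') hne (hoa.symm.trans hoa')

/-- **The sink-trace lonely-relay inequality (PROVED).**  For a relay set `A`, a sink `b ∉ A` and an observer `o`,
with `τ_x = {x ↮ b} ∩ {a ↔ b ∀ a ∈ A, a ≠ x}`, `D_A = {a ↮ b ∀ a ∈ A}` and
`M = D_A ∩ {a ↮ a' ∀ a ≠ a' ∈ A}` of positive probability: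
`Σ_{x∈A} μ({o↔x} ∩ τ_x)/μ(τ_x) ≤ μ((⋃_{a∈A}{o↔a}) ∩ D_A)/μ(D_A)`, i.e.
**`Σ_{x∈A} P(o ↔ x | C_b ∩ A = A∖x) ≤ P(o ↔ A | A ↮ b)`**.
Terms with `μ(τ_x) = 0` vanish (division convention; and `{o↔x} ∩ τ_x ⊆ τ_x`). [this file] -/
theorem sinkTrace_lonelyRelay [Fintype V] (w : Sym2 V → unitInterval) (A : Finset V) (o b : V) (hb : b ∉ A)
    (hM : 0 < (prodBernoulli w).real {ω : BondConfig V | (∀ a ∈ A, ¬ (openGraph ω).Reachable a b) ∧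
      ∀ a ∈ A, ∀ a' ∈ A, a ≠ a' → ¬ (openGraph ω).Reachable a a'}) :
    ∑ x ∈ A, (prodBernoulli w).real ((openConn o x : Set (BondConfig V)) ∩
          {ω | ¬ (openGraph ω).Reachable x b ∧ ∀ a ∈ A, a ≠ x → (openGraph ω).Reachable a b}) /
        (prodBernoulli w).real {ω : BondConfig V | ¬ (openGraph ω).Reachable x b ∧
          ∀ a ∈ A, a ≠ x → (openGraph ω).Reachable a b} ≤
      (prodBernoulli w).real ((⋃ a ∈ A, (openConn o a : Set (BondConfig V))) ∩
          {ω | ∀ a ∈ A, ¬ (openGraph ω).Reachable a b}) /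
        (prodBernoulli w).real {ω : BondConfig V | ∀ a ∈ A, ¬ (openGraph ω).Reachable a b} := by
  set μ := prodBernoulli w with hμ
  set M : Set (BondConfig V) := {ω : BondConfig V | (∀ a ∈ A, ¬ (openGraph ω).Reachable a b) ∧
      ∀ a ∈ A, ∀ a' ∈ A, a ≠ a' → ¬ (openGraph ω).Reachable a a'} with hMdef
  set DA : Set (BondConfig V) := {ω : BondConfig V | ∀ a ∈ A, ¬ (openGraph ω).Reachable a b} with hDAdef
  -- the trace and lonely events of `x`
  let τ : V → Set (BondConfig V) := fun x =>
    {ω | ¬ (openGraph ω).Reachable x b ∧ ∀ a ∈ A, a ≠ x → (openGraph ω).Reachable a b}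
  let σ : V → Set (BondConfig V) := fun x =>
    {ω | ¬ (openGraph ω).Reachable x b ∧ ∀ a ∈ A, a ≠ x → ¬ (openGraph ω).Reachable x a}
  -- (0) `μ(M) ≤ μ(DA)`, so `μ(DA) > 0`
  have hMDA : M ⊆ DA := fun ω hω => hω.1
  have hDApos : 0 < μ.real DA := hM.trans_le (measureReal_mono hMDA)
  -- (1) per relay: `μ(o↔x ∩ τ_x)/μ(τ_x) ≤ μ(o↔x ∩ M)/μ(M)`
  have step : ∀ x ∈ A, μ.real ((openConn o x : Set (BondConfig V)) ∩ τ x) / μ.real (τ x) ≤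
      μ.real ((openConn o x : Set (BondConfig V)) ∩ M) / μ.real M := by
    intro x hx
    -- read the raw rows
    set R : Set (BondConfig V) := {ω : BondConfig V | ∀ s ∈ ({x} : Set V),
        ∀ t ∈ (insert b ↑(A.erase x) : Set V), ¬ (openGraph ω).Reachable s t} with hRdef
    have hR : ∀ ω, ω ∈ R ↔ ω ∈ σ x := fun ω => mem_sepX_iff A b x hb ω
    have e1 : R ∩ ((openConn x o : Set (BondConfig V)) ∩ ⋂ a ∈ A.erase x, (openConn b a : Set (BondConfig V))) =
        (openConn o x : Set (BondConfig V)) ∩ τ x := by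
      ext ω
      simp only [mem_inter_iff, hR ω, mem_iInter₂, openConn, mem_setOf_eq, Finset.mem_erase, σ, τ]
      constructor
      · rintro ⟨⟨hxb, _⟩, hxo, hba⟩
        exact ⟨rs hxo, hxb, fun a ha hax => rs (hba a ⟨hax, ha⟩)⟩
      · rintro ⟨hox, hxb, hab⟩
        exact ⟨⟨hxb, fun a ha hax hxa => hxb (hxa.trans (hab a ha hax))⟩, rs hox,
          fun a ha => rs (hab a ha.2 ha.1)⟩
    have e2 : R ∩ (univ ∩ univ) = σ x := by
      ext ω; simp only [mem_inter_iff, mem_univ, and_true, hR ω]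
    have e3 : R ∩ ((openConn x o : Set (BondConfig V)) ∩ univ) = (openConn o x : Set (BondConfig V)) ∩ σ x := by
      ext ω
      simp only [mem_inter_iff, mem_univ, and_true, hR ω, openConn, mem_setOf_eq]
      constructor
      · rintro ⟨h, hxo⟩; exact ⟨rs hxo, h⟩
      · rintro ⟨hox, h⟩; exact ⟨h, rs hox⟩
    have e4 : R ∩ ((⋂ a ∈ A.erase x, (openConn b a : Set (BondConfig V))) ∩ univ) = τ x := by
      ext ω
      simp only [mem_inter_iff, mem_univ, and_true, hR ω, mem_iInter₂, openConn, mem_setOf_eq,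
        Finset.mem_erase, σ, τ]
      constructor
      · rintro ⟨⟨hxb, _⟩, hba⟩
        exact ⟨hxb, fun a ha hax => rs (hba a ⟨hax, ha⟩)⟩
      · rintro ⟨hxb, hab⟩
        exact ⟨⟨hxb, fun a ha hax hxa => hxb (hxa.trans (hab a ha hax))⟩, fun a ha => rs (hab a ha.2 ha.1)⟩
    have e5 : R ∩ (((⋂ a ∈ A.erase x, (openConn b a : Set (BondConfig V))ᶜ) ∩
        ⋂ a ∈ A.erase x, ⋂ a' ∈ (A.erase x).erase a, (openConn a a' : Set (BondConfig V))ᶜ) ∩ univ) = M := by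
      ext ω
      simp only [mem_inter_iff, mem_univ, and_true, hR ω, mem_iInter₂, mem_compl_iff, openConn, mem_setOf_eq,
        Finset.mem_erase, σ, hMdef]
      constructor
      · rintro ⟨⟨hxb, hxa⟩, hba, haa⟩
        refine ⟨fun a ha => ?_, fun a ha a' ha' hne => ?_⟩
        · by_cases hax : a = x
          · rw [hax]; exact hxb
          · exact fun hab => hba a ⟨hax, ha⟩ (rs hab)
        · by_cases hax : a = x
          · subst hax; exact hxa a' ha' (Ne.symm hne)
          · by_cases ha'x : a' = x
            · subst ha'x; exact fun h => hxa a ha hax (rs h)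
            · exact haa a ⟨hax, ha⟩ a' ⟨Ne.symm hne, ha'x, ha'⟩
      · rintro ⟨hab, haa⟩
        exact ⟨⟨hab x hx, fun a ha hax => haa x hx a ha (Ne.symm hax)⟩,
          fun a ha hba => hab a ha.2 (rs hba), fun a ha a' ha' => haa a ha.2 a' ha'.2.2 (Ne.symm ha'.1)⟩
    have e6 : R ∩ ((openConn x o : Set (BondConfig V)) ∩ ((⋂ a ∈ A.erase x, (openConn b a : Set (BondConfig V))ᶜ) ∩
        ⋂ a ∈ A.erase x, ⋂ a' ∈ (A.erase x).erase a, (openConn a a' : Set (BondConfig V))ᶜ)) =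
        (openConn o x : Set (BondConfig V)) ∩ M := by
      rw [← e5]
      ext ω
      simp only [mem_inter_iff, mem_univ, and_true, openConn, mem_setOf_eq]
      constructor
      · rintro ⟨hRω, hxo, h⟩; exact ⟨rs hxo, hRω, h⟩
      · rintro ⟨hox, hRω, h⟩; exact ⟨hRω, rs hox, h⟩
    have row1 := trace_le_lonely_set w A o b x
    rw [e1, e2, e3, e4] at row1
    have row2 := lonely_le_sep_set w A o b x
    rw [e3, e5, e6, e2] at row2
    -- row1 : μ(ox ∩ τ) * μ(σ) ≤ μ(ox ∩ σ) * μ(τ);  row2 : μ(ox ∩ σ) * μ(M) ≤ μ(ox ∩ M) * μ(σ)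
    have hτσ : τ x ⊆ σ x := fun ω hω => ⟨hω.1, fun a ha hax hxa => hω.1 (hxa.trans (hω.2 a ha hax))⟩
    have hτ0 : 0 ≤ μ.real (τ x) := measureReal_nonneg
    rcases eq_or_lt_of_le hτ0 with hτz | hτpos
    · -- `μ(τ_x) = 0`: the term is `0`
      rw [← hτz, div_zero]
      exact div_nonneg measureReal_nonneg hM.le
    have hσpos : 0 < μ.real (σ x) := hτpos.trans_le (measureReal_mono hτσ)
    have i1 : μ.real ((openConn o x : Set (BondConfig V)) ∩ τ x) / μ.real (τ x) ≤
        μ.real ((openConn o x : Set (BondConfig V)) ∩ σ x) / μ.real (σ x) := by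
      rw [div_le_div_iff₀ hτpos hσpos]; exact row1
    have i2 : μ.real ((openConn o x : Set (BondConfig V)) ∩ σ x) / μ.real (σ x) ≤
        μ.real ((openConn o x : Set (BondConfig V)) ∩ M) / μ.real M := by
      rw [div_le_div_iff₀ hσpos hM]; exact row2
    exact i1.trans i2
  -- (2) disjointness: `Σ_x μ(o↔x ∩ M) ≤ μ((⋃ o↔a) ∩ M)`
  have hdisj : ∑ x ∈ A, μ.real ((openConn o x : Set (BondConfig V)) ∩ M) ≤
      μ.real ((⋃ a ∈ A, (openConn o a : Set (BondConfig V))) ∩ M) := by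
    rw [← measureReal_biUnion_finset (pairwiseDisjoint_conn_inter_sep A o M (fun ω hω => hω.2))
      (fun a _ => MeasurableSet.of_discrete)]
    refine measureReal_mono ?_
    intro ω hω
    obtain ⟨a, ha, hωa⟩ := mem_iUnion₂.1 hω
    exact ⟨mem_iUnion₂.2 ⟨a, ha, hωa.1⟩, hωa.2⟩
  -- (3) `μ((⋃ o↔a) ∩ M) · μ(DA) ≤ μ(M) · μ((⋃ o↔a) ∩ DA)`
  have row3 := join_sep_le_set w A o b
  set R3 : Set (BondConfig V) := {ω : BondConfig V | ∀ s ∈ ({b} : Set V), ∀ t ∈ (↑A : Set V),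
      ¬ (openGraph ω).Reachable s t} with hR3def
  have hR3 : ∀ ω, ω ∈ R3 ↔ ω ∈ DA := by
    intro ω
    simp only [hR3def, hDAdef, mem_setOf_eq, mem_singleton_iff, forall_eq, Finset.mem_coe]
    exact ⟨fun h a ha hab => h a ha (rs hab), fun h a ha hba => h a ha (rs hba)⟩
  have hP : ∀ ω, ω ∈ (⋂ a ∈ A, ⋂ a' ∈ A.erase a, (openConn a a' : Set (BondConfig V))ᶜ) ↔
      ∀ a ∈ A, ∀ a' ∈ A, a ≠ a' → ¬ (openGraph ω).Reachable a a' := by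
    intro ω
    simp only [mem_iInter₂, mem_compl_iff, openConn, mem_setOf_eq, Finset.mem_erase]
    exact ⟨fun h a ha a' ha' hne => h a ha a' ⟨Ne.symm hne, ha'⟩, fun h a ha a' ha' => h a ha a' ha'.2 (Ne.symm ha'.1)⟩
  have hO : ∀ ω, ω ∈ (⋃ a ∈ A, (openConn a o : Set (BondConfig V))) ↔
      ω ∈ (⋃ a ∈ A, (openConn o a : Set (BondConfig V))) := by
    intro ω
    simp only [mem_iUnion₂, openConn, mem_setOf_eq]
    exact ⟨fun ⟨a, ha, h⟩ => ⟨a, ha, rs h⟩, fun ⟨a, ha, h⟩ => ⟨a, ha, rs h⟩⟩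
  have f1 : R3 ∩ ((⋂ a ∈ A, ⋂ a' ∈ A.erase a, (openConn a a' : Set (BondConfig V))ᶜ) ∩
      ⋃ a ∈ A, (openConn a o : Set (BondConfig V))) = (⋃ a ∈ A, (openConn o a : Set (BondConfig V))) ∩ M := by
    ext ω
    rw [mem_inter_iff, mem_inter_iff, hR3, hP, hO, mem_inter_iff]
    simp only [hDAdef, hMdef, mem_setOf_eq]
    tauto
  have f2 : R3 ∩ (univ ∩ univ) = DA := by
    ext ω; simp only [mem_inter_iff, mem_univ, and_true, hR3 ω]
  have f3 : R3 ∩ ((⋂ a ∈ A, ⋂ a' ∈ A.erase a, (openConn a a' : Set (BondConfig V))ᶜ) ∩ univ) = M := by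
    ext ω
    rw [mem_inter_iff, mem_inter_iff, hR3, hP]
    simp only [hDAdef, hMdef, mem_setOf_eq, mem_univ, and_true]
  have f4 : R3 ∩ ((⋃ a ∈ A, (openConn a o : Set (BondConfig V))) ∩ univ) =
      (⋃ a ∈ A, (openConn o a : Set (BondConfig V))) ∩ DA := by
    ext ω
    rw [mem_inter_iff, mem_inter_iff, hR3, hO, mem_inter_iff]
    simp only [mem_univ, and_true]
    tauto
  rw [f1, f2, f3, f4] at row3
  -- row3 : μ(OA ∩ M) * μ(DA) ≤ μ(M) * μ(OA ∩ DA)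
  have i3 : μ.real ((⋃ a ∈ A, (openConn o a : Set (BondConfig V))) ∩ M) / μ.real M ≤
      μ.real ((⋃ a ∈ A, (openConn o a : Set (BondConfig V))) ∩ DA) / μ.real DA := by
    rw [div_le_div_iff₀ hM hDApos]; linarith
  -- (4) assemble
  calc ∑ x ∈ A, μ.real ((openConn o x : Set (BondConfig V)) ∩ τ x) / μ.real (τ x)
      ≤ ∑ x ∈ A, μ.real ((openConn o x : Set (BondConfig V)) ∩ M) / μ.real M := Finset.sum_le_sum step
    _ = (∑ x ∈ A, μ.real ((openConn o x : Set (BondConfig V)) ∩ M)) / μ.real M := by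
        rw [Finset.sum_div]
    _ ≤ μ.real ((⋃ a ∈ A, (openConn o a : Set (BondConfig V))) ∩ M) / μ.real M :=
        div_le_div_of_nonneg_right hdisj hM.le
    _ ≤ μ.real ((⋃ a ∈ A, (openConn o a : Set (BondConfig V))) ∩ DA) / μ.real DA := i3

end SinkTrace

end Summit.CriticalPhenomena.PercolationContinuityZ3.Theorems

end
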